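import Mathlib.RingTheory.Localization.AtPrime.Basic
import Mathlib.Algebra.CharP.Algebra
import Literature.AlgebraicGeometry.Resolution.FormalEquidimensionality
import Literature.AlgebraicGeometry.Resolution.RegularLocalRingsProofs
import HarnessLib

/-!
# Localizing a prime quotient of a regular local ring (crux `FrobeniusLadder.FRationalResolution`, line `Sketch`)

Stub `exists_atPrime_quotient_ringEquiv_regularLocal_quotient` of the skeleton `Sketch` for crux
stmt-ResolutionOfSingularities-15317 (theme LOC: F-rationality localizes, for the rings `S/Q` the
route meets). For `S` regular local of characteristic `p`, `Q` a prime of `S`, `P` a prime of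
`S/Q` and `A` a localization of `S/Q` at `P`, the ring `A` is again "regular local modulo a prime":
`A ≅ S'/Q'` with `S' := S_{P̃}` (`P̃` the preimage of `P` in `S`; regular local by Serre's theorem,
Matsumura Thm. 19.3, `Literature.AlgebraicGeometry.Resolution.isRegularLocalRing_localization_atPrime`)
and `Q' := Q S'` (prime since `Q ⊆ P̃`). The isomorphism is
`A ≅ (S/Q)_P ≅ S_{P̃} / (ker (S → S/Q)) S_{P̃} = S'/Q'`
(`IsLocalization.algEquiv`, the tree presentation
`Literature.AlgebraicGeometry.Resolution.exists_ringEquiv_localization_quotient_map_ker`, and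
`Ideal.mk_ker`). `S'` has characteristic `p` because `S` is a domain, so `S → S'` is injective.
-/

set_option linter.dupNamespace false

noncomputable section

namespace Summit.ResolutionOfSingularities.ResolutionOfSingularities.Theorems.FRationalResolution

open IsLocalRing Literature.AlgebraicGeometry.Resolution

/-- **Localizing `S/Q` at a prime gives again a prime quotient of a regular local ring.** For `S`
regular local of characteristic `p`, `Q ⊆ S` prime, `P ⊆ S/Q` prime and `A = (S/Q)_P`, there are a
regular local ring `S'` of characteristic `p` (namely `S_{P̃}`, `P̃` the preimage of `P`, regular by
Serre's theorem) and a prime `Q' = Q S'` with `A ≅ S'/Q'`. -/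
theorem exists_atPrime_quotient_ringEquiv_regularLocal_quotient (p : ℕ) [Fact p.Prime] (S : Type)
    [CommRing S] [IsRegularLocalRing S] [CharP S p] (Q : Ideal S) [Q.IsPrime]
    (P : Ideal (S ⧸ Q)) [P.IsPrime] (A : Type) [CommRing A] [Algebra (S ⧸ Q) A]
    [IsLocalization.AtPrime A P] :
    ∃ (S' : Type) (_ : CommRing S') (_ : IsRegularLocalRing S') (_ : CharP S' p) (Q' : Ideal S')
      (_ : Q'.IsPrime), Nonempty (A ≃+* S' ⧸ Q') := by
  -- the presentation `f : S → S/Q`, the preimage prime `P̃` and `S' := S_{P̃}`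
  set f : S →+* S ⧸ Q := Ideal.Quotient.mk Q
  have hf : Function.Surjective f := Ideal.Quotient.mk_surjective
  have hker : RingHom.ker f = Q := Ideal.mk_ker
  set Pt : Ideal S := P.comap f
  set S' := Localization.AtPrime Pt
  -- (1) `S'` is regular local (Serre)
  have hreg : IsRegularLocalRing S' := isRegularLocalRing_localization_atPrime S Pt
  -- (2) `S'` has characteristic `p`: `S` is a domain, so `S → S'` is injective
  haveI : IsDomain S := isDomain_of_isRegularLocalRing S
  have hinj : Function.Injective (algebraMap S S') :=
    IsLocalization.injective S' Pt.primeCompl_le_nonZeroDivisors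
  have hchar : CharP S' p := charP_of_injective_algebraMap hinj p
  -- (3) `Q' := Q S'` is prime, as `Q ⊆ P̃`
  have hQle : Q ≤ Pt := by
    rw [← hker]
    exact Ideal.ker_le_comap f
  have hdisj : Disjoint (Pt.primeCompl : Set S) (Q : Set S) := by
    rw [Set.disjoint_left]
    intro x hx hxQ
    exact hx (hQle hxQ)
  have hQ' : (Q.map (algebraMap S S')).IsPrime :=
    IsLocalization.isPrime_of_isPrime_disjoint Pt.primeCompl S' Q ‹Q.IsPrime› hdisj
  -- (4) the isomorphism `A ≅ (S/Q)_P ≅ S'/(ker f) S' = S'/Q S'`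
  obtain ⟨e⟩ := exists_ringEquiv_localization_quotient_map_ker f hf P
  have e₀ : A ≃+* Localization.AtPrime P :=
    (IsLocalization.algEquiv P.primeCompl A (Localization.AtPrime P)).toRingEquiv
  have e₁ : S' ⧸ (RingHom.ker f).map (algebraMap S S') ≃+* S' ⧸ Q.map (algebraMap S S') :=
    Ideal.quotEquivOfEq (by rw [hker])
  exact ⟨S', inferInstance, hreg, hchar, Q.map (algebraMap S S'), hQ', ⟨(e₀.trans e).trans e₁⟩⟩

end Summit.ResolutionOfSingularities.ResolutionOfSingularities.Theorems.FRationalResolution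

end
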